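import Summits.BirchSwinnertonDyer.BirchSwinnertonDyer.Theorems.GenusKolyvaginAtTwoKolyvaginExactAtTwoOfSplitR

/-!
# Route `GenusKolyvaginAtTwo`: the R-glue item `KolyvaginExactAtTwoOfSplitR` holds (by name)

Item stmt-BirchSwinnertonDyer-27970 (`KolyvaginExactAtTwoOfSplitR`, support/glue of the LINE-6 split of crux
stmt-BirchSwinnertonDyer-22137 `KolyvaginExactAtTwo`, re-threaded through the repaired children Q5R
`EquivariantChebotarevAtTwoR` (27280, closed) and Q3R `EquivariantKolyvaginExactAtTwoR` (27720, key), route rev 17/18).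
Pen seat `bsd-idea-1` g7. THEOREM-ONLY file (no definition, no named fact, no `sorry`).

The statement is, verbatim, the type of the landed turnkey
`Theorems.GenusExact.kolyvaginExactAtTwo_of_splitR` (seat gk2-p3 g11): pure logic — an elliptic curve has `Δ ≠ 0`;
on `Δ < 0` feed Q2, Q5R, Q1 to Q3R, on `0 < Δ` use the residual Q4. BSD is not proved by any of this; the parent
crux `KolyvaginExactAtTwo` is not proved either (this closes the GLUE item only: children ⟹ parent); Q2, Q3R, Q4 stay open.
-/

set_option autoImplicit false
set_option linter.dupNamespace false

namespace Summit.BirchSwinnertonDyer.BirchSwinnertonDyer.Theorems.GenusExact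

open Summit.BirchSwinnertonDyer.BirchSwinnertonDyer.Theses.GenusKolyvaginAtTwo

/-- **R-glue of the LINE-6 split of `KolyvaginExactAtTwo`** (item stmt-BirchSwinnertonDyer-27970, by name):
`CyclicTorsionOfNegDisc → KolyvaginRelationAtTwo → EquivariantChebotarevAtTwoR →
EquivariantKolyvaginExactAtTwoR → KolyvaginExactAtTwoPosDisc → KolyvaginExactAtTwo`.
Proof: `kolyvaginExactAtTwo_of_splitR` (case on the sign of `Δ(W) ≠ 0`). [folklore] -/
theorem kolyvaginExactAtTwoOfSplitR_proof : KolyvaginExactAtTwoOfSplitR :=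
  kolyvaginExactAtTwo_of_splitR

end Summit.BirchSwinnertonDyer.BirchSwinnertonDyer.Theorems.GenusExact
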